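import Mathlib
import Literature.AlgebraicGeometry.Resolution.CutkoskySurfaceOmegaSequence
import Literature.AlgebraicGeometry.Cutkosky2009.Sec9Gamma
import HarnessLib

/-!
# Cutkosky 2009, §9: the sequence (11) is finite when `τ(q) = 2` (named fact), and the invariant `γ(J; x, y, z)` of (12)

Topic: `Literature/AlgebraicGeometry/Resolution`.  S. D. Cutkosky, *Resolution of singularities for
3-folds in positive characteristic*, Amer. J. Math. **131** (2009) 59–127 [cite: Cutkosky2009], §9
"Reduction when `τ(q) = 2`", author version (held copy `paper:doi-10-1353-ajm-0-0036`; locator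
"p. N l. M" = page N, line M of its text layer) p. 25 l. 42 – p. 27 l. 57.  The companion of
`CutkoskySurfaceOmegaSequence.lean` (Theorem 10.18, the case `τ(q) = 1`, named fact
`Cutkosky2009_Thm10_18` over `Cutkosky2009.TauOneChain`): the same sequence (11) of completed local
rings in the case `τ(q) = 2`, and the printed conclusion of §9, p. 27 l. 45–56:

> "We now prove that (11) cannot have infinite length.  Since `τ(q_i) = 2` for all `i`, the
> assumption that (11) is infinite and Lemma 5.1 imply that for all `i`, `Sing_r(I_i)` is the maximal
> ideal of `R_i` and `R_{i+1}` is the completion of a local ring of a closed point of the blow up of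
> the maximal ideal of `Spec(R_i)`.  Moreover, `τ(q) = 2` implies that there exist regular
> parameters `(x, y, z)` in `R_0` such that `V(y, z)` is an approximate manifold of `I_0`, and thus
> `x, y, z` are good parameters for `I_0`.  By Lemma 9.2, there exists a change of variables in `R_0`
> so that we find good parameters `x, y, z` for `I_0` such that `I_0` is not solvable with respect to
> `x, y, z`.  Set `Ω(q_0) = γ(I_0; x, y, z)`.  By Lemma 9.3, we can inductively define positive
> rational numbers `Ω(q_n)` such that `Ω(q_{n+1}) = Ω(q_n) − 1` for all `n`, giving a contradiction
> if (11) has infinite length."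

with the setting p. 25 l. 46–48 ("Suppose that `T` is a power series ring in 3 variables over an
algebraically closed field `k`, and `J ⊂ T` is an ideal.  Suppose that `x, y, z` are regular
parameters in `T`, and `r` is a positive integer") and the context of (11) quoted in
`CutkoskySurfaceOmegaSequence.lean` (p. 25 l. 20–40: "an infinite sequence of points
`q_n ∈ Sing_r(I_n)` … `R_i = 𝒪̂_{V_i,q_i}` … `ν_{q_i}(I_i) = r` for all `i` … `τ(q_n) = τ(I_n)` for
all `n`").

## What is typed

* `Cutkosky2009.TauLETwo`, `Cutkosky2009.TauTwo` — "`τ(I) = 2`" expansion-free, next to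
  `Cutkosky2009.TauOne` (§5 p. 17 l. 35–38: `τ` = "the dimension of the smallest linear subspace `T`
  of the `k`-subspace spanned by `x_1, …, x_n` … such that `L ∈ k[T]` for all `f ∈ I_p`"): all
  `r`-leading forms lie in `k[ū_0, ū_1]` for two members `u 0, u 1` of a regular system of parameters
  (`I ⊆ (u 0, u 1)^r + 𝔪^{r+1}`), and no single linear form works (`¬ TauOne I r`).
* `Cutkosky2009.gammaSec9Val`, `Cutkosky2009.gammaSec9` — the invariant `γ(J; x, y, z)` of (12)
  (p. 25 l. 50–57: "`γ(g; x, y, z) = min{ k/(r − (i+j)) | b_{ijk} ≠ 0 and i + j < r } ∈ (1/r!)ℕ ∪ {∞}`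
  … `γ(J; x, y, z) = min{γ(g; x, y, z) | g ∈ J}`.  We have `γ(J; x, y, z) = ∞` if and only if
  `J ⊂ (x, y)^r`"), scaled by `r!` and valued in `ℕ∞`, read EXPANSION-FREE on the tree's Newton
  points `occ c J` (`WeightedInitialTerms`; dictionary `c = (z, x, y)`: `e 0` = the `z`-degree `k`,
  `e 1 + e 2` = the degree `i + j` in the leading variables).  Since "`γ ≥ q`" is the half-plane
  condition `k + q(i + j) ≥ q r` on the Newton polyhedron, the minimum over occurring monomials is the
  minimum over its vertices, which is what `occ` records; the exponent arithmetic of `γ` under the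
  substitution (16) is ALREADY in the tree (`Cutkosky2009.Sec9Gamma`: `gam`, `LB`, `tr16`,
  `LB_image_tr16_iff` = Lemma 9.3 (3) on exponents, `sec9_exponent_termination`), and
  `gammaSec9Val_eq_factorial_mul_gam` is the bridge to it.
* `Cutkosky2009.TauTwoChain` — the sequence (11) in the case `τ(q) = 2`, mirroring `TauOneChain`:
  ideals `I n ⊂ R_n = k⟦x, y, z⟧` of order exactly `r ≥ 1` with `τ(I_n) = 2`, and — carried as
  HYPOTHESIS FIELDS exactly as the printed argument states them at p. 27 l. 46–49 (it derives them from
  Lemma 5.1, which is NOT typed here) — "for all `i`, `Sing_r(I_i)` is the maximal ideal of `R_i`"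
  (`singR_point`) "and `R_{i+1}` is the completion of a local ring of a closed point of the blow up of
  the maximal ideal of `Spec(R_i)`" (`step`: every step is a POINT step `IsPointStep` of
  `CutkoskySurfaceOmegaSequence.lean`, `I_{n+1}` the weak transform; `k = k̄`, so the closed point
  `q_{n+1}` is the origin of the first chart for a suitable regular system of parameters).
* the named fact `Cutkosky2009_Sec9_tauTwo : ∀ k = k̄, ∀ r, IsEmpty (TauTwoChain k r)` — "(11) cannot
  have infinite length" when `τ(q) = 2` — statement only, NOT proved here;
* PROVED bookkeeping: `no_enat_unit_descent` (the order half of p. 27 l. 55–56 in the `ℕ∞` scaling: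
  no sequence in `ℕ ∪ {∞}` with finite first term drops by a fixed `L ≥ 1` at every step; the
  rational form is `Cutkosky2009.DatumReduction.sec9_termination`), the unfolding lemmas of `TauTwo` /
  `gammaSec9`, and `false_of_tauTwoChain` (using the fact).

## Scope (honest)

Sequence form over ABSTRACT chains, as F-63 (`Cutkosky2009_Thm10_18`): the fact quantifies over all
`TauTwoChain`s; the geometric dictionary (building such a chain from an actual infinite sequence of
point blow-ups with `τ ≡ 2`, including the two Lemma 5.1 consequences above) is the user's.  The proof
notions of §9 — good parameters for `τ = 2` (p. 26 l. 56–59), "solvable" (Def. 9.1), Lemma 9.2,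
Lemma 9.3 — are NOT typed (only `γ` of (12) is); nothing algorithmic ("which centre") is part of the
fact.  `k` algebraically closed as printed.  AI transcription of the text layer of the held copy,
formula glyphs re-read in context; weaker than expert review.

## Sources

* S. D. Cutkosky, Amer. J. Math. 131 (2009): §5 p. 17 l. 35–38 (`τ`); (11) p. 25 l. 20–40; §9
  p. 25 l. 42 – p. 27 l. 57, esp. (12) p. 25 l. 50–57 and the closing argument p. 27 l. 45–56;
  Def. 10.10 p. 31 l. 36 – p. 32 l. 4 (the chart of a point step). [Cutkosky2009]
-/

noncomputable section

open IsLocalRing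

namespace Literature.AlgebraicGeometry.Resolution.Cutkosky2009

universe u

/-! ## `τ(I) = 2`, expansion-free -/
section Local
variable {R : Type u} [CommRing R] [IsLocalRing R]

/-- `τ(I) ≤ 2` for an ideal of order `r`: all `r`-leading forms of elements of `I` lie in
`k[ū_0, ū_1]` for two members `u 0, u 1` of a regular system of parameters `u`, expansion-free:
`I ⊆ (u 0, u 1)^r + 𝔪^{r+1}`. [cite: Cutkosky2009, §5 p. 17 l. 35–38] -/
def TauLETwo (I : Ideal R) (r : ℕ) : Prop :=
  ∃ u : Fin 3 → R, IsParams u ∧ I ≤ Ideal.span {u 0, u 1} ^ r ⊔ maximalIdeal R ^ (r + 1)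

/-- `τ(I) = 2` for an ideal of order exactly `r ≥ 1` ("the dimension of the smallest linear subspace
`T` … such that `L ∈ k[T]` for all `f ∈ I`" is `2`): some plane `k ū_0 ⊕ k ū_1` contains all
`r`-leading forms (`TauLETwo`) and no line does (`¬ TauOne`). [cite: Cutkosky2009, §5 p. 17 l. 35–38; §9 p. 25 l. 42–45] -/
def TauTwo (I : Ideal R) (r : ℕ) : Prop := TauLETwo I r ∧ ¬ TauOne I r

/-- Unfolding. [cite: Cutkosky2009, §5 p. 17 l. 35–38] -/
theorem TauTwo.tauLETwo {I : Ideal R} {r : ℕ} (h : TauTwo I r) : TauLETwo I r := h.1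

/-- Unfolding: `τ = 2` excludes `τ = 1`. [cite: Cutkosky2009, §5 p. 17 l. 35–38] -/
theorem TauTwo.not_tauOne {I : Ideal R} {r : ℕ} (h : TauTwo I r) : ¬ TauOne I r := h.2

/-- An ideal inside `(u 0, u 1)^r` for a regular system of parameters `u` has `τ ≤ 2` (e.g. the ideal
of an `r`-fold curve `V(u 0, u 1)`). [cite: Cutkosky2009, §9 p. 25 l. 57–58] -/
theorem tauLETwo_of_le_span_pow {I : Ideal R} {r : ℕ} {u : Fin 3 → R} (hu : IsParams u)
    (h : I ≤ Ideal.span {u 0, u 1} ^ r) : TauLETwo I r :=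
  ⟨u, hu, h.trans le_sup_left⟩

end Local

/-! ## The invariant `γ(J; x, y, z)` of (12), scaled by `r!`, on Newton points -/
section Gamma
variable {R : Type u} [CommRing R]

/-- The scaled value `r! · k/(r − (i + j))` of ONE exponent `e = (k, i, j)` (tree order `c = (z, x, y)`:
`e 0 = k` the `z`-degree, `e 1 + e 2 = i + j` the degree in the leading variables), meaningful when
`i + j < r`; a natural number since `r − (i + j)` divides `r!` ("`∈ (1/r!)ℕ`").
[cite: Cutkosky2009, (12), p. 25 l. 50–56] -/
def gammaSec9Val (r : ℕ) (e : Fin 3 →₀ ℕ) : ℕ := e 0 * (r.factorial / (r - (e 1 + e 2)))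

/-- **`r! · γ(J; x, y, z) ∈ ℕ ∪ {∞}`** ((12): "`γ(g; x, y, z) = min{ k/(r − (i+j)) | b_{ijk} ≠ 0 and
i + j < r }`", "`γ(J; x, y, z) = min{γ(g; x, y, z) | g ∈ J}`"), read on the Newton points `occ c J` of
`J` in the parameters `c = (z, x, y)` (the minimum of `k/(r − (i+j))` over the occurring monomials with
`i + j < r` is attained at a vertex of the Newton polyhedron, since "`γ ≥ q`" is the half-plane
`k + q(i + j) ≥ q r`); `⊤` when no Newton point has `i + j < r` ("`γ = ∞` if and only if
`J ⊂ (x, y)^r`"). [cite: Cutkosky2009, (12), p. 25 l. 50–58] -/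
def gammaSec9 (c : Fin 3 → R) (J : Ideal R) (r : ℕ) : ℕ∞ :=
  sInf ((fun e => (gammaSec9Val r e : ℕ∞)) '' {e | e ∈ occ c J ∧ e 1 + e 2 < r})

/-- Bridge to the exponent model `Cutkosky2009.Sec9Gamma` (pairs `(s, k) = (i + j, k)`,
`gam r (s, k) = k/(r − s)`): `gammaSec9Val r e = r! · gam r (e 1 + e 2, e 0)` for `e 1 + e 2 < r`.
[cite: Cutkosky2009, (12), p. 25 l. 50–56] -/
theorem gammaSec9Val_eq_factorial_mul_gam {r : ℕ} (e : Fin 3 →₀ ℕ) (he : e 1 + e 2 < r) :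
    (gammaSec9Val r e : ℚ) = (r.factorial : ℚ) * _root_.Literature.AlgebraicGeometry.Cutkosky2009.Sec9Gamma.gam r (e 1 + e 2, e 0) := by
  obtain ⟨q, hq⟩ : (r - (e 1 + e 2)) ∣ r.factorial := Nat.dvd_factorial (by omega) (by omega)
  have hpos : 0 < r - (e 1 + e 2) := by omega
  have hdiv : r.factorial / (r - (e 1 + e 2)) = q := by
    rw [hq, Nat.mul_div_cancel_left _ hpos]
  unfold gammaSec9Val _root_.Literature.AlgebraicGeometry.Cutkosky2009.Sec9Gamma.gam
  rw [hdiv, hq]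
  have hne : (r : ℚ) - ((e 1 : ℚ) + (e 2 : ℚ)) ≠ 0 := by
    have : (e 1 : ℚ) + (e 2 : ℚ) < r := by exact_mod_cast he
    linarith
  have hsub : (((r - (e 1 + e 2) : ℕ)) : ℚ) = (r : ℚ) - ((e 1 : ℚ) + (e 2 : ℚ)) := by
    rw [Nat.cast_sub he.le]; push_cast; ring
  push_cast
  rw [hsub]
  field_simp

/-- Unfolding: "`q ≤ γ(J; x, y, z)`" (scaled: `N ≤ r!·γ`) iff `N ≤ r!·k/(r − (i+j))` for every Newton
point with `i + j < r`. [cite: Cutkosky2009, (12), p. 25 l. 50–57] -/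
theorem le_gammaSec9_iff (c : Fin 3 → R) (J : Ideal R) (r : ℕ) (N : ℕ∞) :
    N ≤ gammaSec9 c J r ↔ ∀ e ∈ occ c J, e 1 + e 2 < r → N ≤ (gammaSec9Val r e : ℕ∞) := by
  unfold gammaSec9
  rw [le_sInf_iff]
  constructor
  · intro h e he hlt
    exact h _ ⟨e, ⟨he, hlt⟩, rfl⟩
  · rintro h _ ⟨e, ⟨he, hlt⟩, rfl⟩
    exact h e he hlt

/-- "`γ(J; x, y, z) = ∞` if and only if `J ⊂ (x, y)^r`", on Newton points: `r!·γ = ⊤` iff no Newton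
point of `J` has degree `< r` in the leading variables. [cite: Cutkosky2009, p. 25 l. 57–58] -/
theorem gammaSec9_eq_top_iff (c : Fin 3 → R) (J : Ideal R) (r : ℕ) :
    gammaSec9 c J r = ⊤ ↔ ∀ e ∈ occ c J, r ≤ e 1 + e 2 := by
  unfold gammaSec9
  rw [sInf_eq_top]
  constructor
  · intro h e he
    by_contra hlt
    push Not at hlt
    exact ENat.coe_ne_top _ (h _ ⟨e, ⟨he, hlt⟩, rfl⟩)
  · rintro h _ ⟨e, ⟨he, hlt⟩, rfl⟩
    exact absurd (h e he) (by omega)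

/-- **The order half of the closing argument** (p. 27 l. 55–56: "positive rational numbers `Ω(q_n)`
such that `Ω(q_{n+1}) = Ω(q_n) − 1` for all `n`, giving a contradiction if (11) has infinite
length"), in the `ℕ∞` scaling of `gammaSec9`: no sequence in `ℕ ∪ {∞}` with finite first term drops
by a fixed `L ≥ 1` at every step.  (Rational form: `Cutkosky2009.DatumReduction.sec9_termination`.)
[cite: Cutkosky2009, §9 p. 27 l. 55–56] -/
theorem no_enat_unit_descent (f : ℕ → ℕ∞) (h0 : f 0 ≠ ⊤) {L : ℕ} (hL : 0 < L)
    (hstep : ∀ n, f (n + 1) + L = f n) : False := by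
  obtain ⟨N, hN⟩ := ENat.ne_top_iff_exists.mp h0
  have hsum : ∀ n, f n + (n * L : ℕ) = f 0 := by
    intro n
    induction n with
    | zero => simp
    | succ n ih =>
      rw [← ih, ← hstep n, add_assoc, ← ENat.coe_add]
      congr 2
      ring
  have hle : (((N + 1) * L : ℕ) : ℕ∞) ≤ (N : ℕ∞) := by
    rw [hN, ← hsum (N + 1)]
    exact le_add_self
  have : (N + 1) * L ≤ N := by exact_mod_cast hle
  nlinarith

end Gamma

/-! ## The sequence (11) in the case `τ(q) = 2` -/
section Chain
variable (k : Type u) [Field k]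

/-- **The sequence (11) in the case `τ(q) = 2`** (the context of §9's closing argument), over an
algebraically closed field `k`, all rings `R_n = k⟦x, y, z⟧`: ideals `I n` of order exactly `r ≥ 1`
("`ν_{q_i}(I_i) = r` for all `i`", "`r` is a positive integer") with "`τ(q_i) = 2` for all `i`", and,
carried as hypothesis fields exactly as the printed argument states them (p. 27 l. 46–49, where they
are derived from Lemma 5.1 and the infinitude of (11)): "for all `i`, `Sing_r(I_i)` is the maximal
ideal of `R_i`" and "`R_{i+1}` is the completion of a local ring of a closed point of the blow up of
the maximal ideal of `Spec(R_i)`", `I_{i+1}` the weak transform — a point step `IsPointStep` (the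
closed point `q_{i+1}`, `k`-rational as `k = k̄`, is the origin of the first chart for a suitable
regular system of parameters).  Mirrors `TauOneChain` (there: `τ = 1`, curve or point steps).
[cite: Cutkosky2009, (11) p. 25 l. 20–40; §9 p. 25 l. 46–48, p. 27 l. 45–49] -/
structure TauTwoChain [IsAlgClosed k] (r : ℕ) where
  /-- the ideals `I_n = (𝓘_n)_{q_n} R_n` -/
  I : ℕ → Ideal (MvPowerSeries (Fin 3) k)
  /-- the maps `R_n → R_{n+1}` of completed local rings -/
  φ : ℕ → (MvPowerSeries (Fin 3) k →ₐ[k] MvPowerSeries (Fin 3) k)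
  /-- "`r` is a positive integer" (p. 25 l. 48) -/
  one_le : 1 ≤ r
  /-- "`ν_{q_i}(I_i) = r` for all `i`" (p. 25 l. 34) -/
  hasOrder : ∀ n, HasOrder (I n) r
  /-- "`τ(q_i) = 2` for all `i`" (p. 27 l. 46; "`τ(q_n) = τ(I_n)`", p. 25 l. 36–37) -/
  tauTwo : ∀ n, TauTwo (I n) r
  /-- "for all `i`, `Sing_r(I_i)` is the maximal ideal of `R_i`" (p. 27 l. 46–47) -/
  singR_point : ∀ n P, P ≠ maximalIdeal _ → ¬ InSingR (I n) r P
  /-- "`R_{i+1}` is the completion of a local ring of a closed point of the blow up of the maximal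
  ideal of `Spec(R_i)`" (p. 27 l. 47–49), `I_{i+1}` the weak transform (Def. 10.10 p. 31 l. 36 – p. 32 l. 4) -/
  step : ∀ n, IsPointStep (I n) (I (n + 1)) (φ n) r

end Chain

/-! ## The named fact -/

/-- **Cutkosky 2009, §9 (the case `τ(q) = 2`)** (named fact, statement only): "We now prove that (11)
cannot have infinite length" (p. 27 l. 45) — along no sequence (11) with `τ(q_i) = 2` for all `i`,
i.e. there is no `TauTwoChain` over an algebraically closed field `k` (any characteristic, any
`r ≥ 1`).  Printed proof: Lemma 9.2 supplies good parameters for which `I_0` is not solvable, and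
Lemma 9.3 then gives "positive rational numbers `Ω(q_n)`" (`= γ(I_n; x_n, y_n, z_n)` of (12),
`gammaSec9`) "such that `Ω(q_{n+1}) = Ω(q_n) − 1` for all `n`, giving a contradiction"
(`no_enat_unit_descent`).  NOT the step-local reading; NOT proved here; the two Lemma 5.1
consequences of p. 27 l. 46–49 are hypothesis fields of the chain (see `TauTwoChain`).
[cite: Cutkosky2009, §9 p. 27 l. 45–56] -/
def _root_.Literature.AlgebraicGeometry.Resolution.Cutkosky2009_Sec9_tauTwo : Prop :=
  ∀ (k : Type) [Field k] [IsAlgClosed k] (r : ℕ), IsEmpty (TauTwoChain k r)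

/-- Unfolding: under the named fact, a `τ = 2` chain is contradictory ("(11) cannot have infinite
length"). [cite: Cutkosky2009, §9 p. 27 l. 45] -/
theorem false_of_tauTwoChain (h : Cutkosky2009_Sec9_tauTwo) {k : Type} [Field k] [IsAlgClosed k]
    {r : ℕ} (C : TauTwoChain k r) : False :=
  (h k r).false C

/-- How the fact is meant to be discharged (the order skeleton of p. 27 l. 52–56, PROVED): if along a
`τ = 2` chain one has parameters `c n` in which `r!·γ(I_n; c n)` is finite at `n = 0` and drops by
`r!` at every step ("`Ω(q_{n+1}) = Ω(q_n) − 1`"), the chain is contradictory.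
[cite: Cutkosky2009, §9 p. 27 l. 52–56] -/
theorem false_of_gammaSec9_drop {k : Type u} [Field k] [IsAlgClosed k] {r : ℕ} (C : TauTwoChain k r)
    (c : ℕ → (Fin 3 → MvPowerSeries (Fin 3) k)) (h0 : gammaSec9 (c 0) (C.I 0) r ≠ ⊤)
    (hdrop : ∀ n, gammaSec9 (c (n + 1)) (C.I (n + 1)) r + r.factorial = gammaSec9 (c n) (C.I n) r) :
    False :=
  no_enat_unit_descent (fun n => gammaSec9 (c n) (C.I n) r) h0 (Nat.factorial_pos r) hdrop

end Literature.AlgebraicGeometry.Resolution.Cutkosky2009
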